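import Literature.Analysis.Matrix.CoerciveCombesThomas

/-!
# The pointwise-coercive Combes–Thomas bound: exponential decay of `A⁻¹` with an amplitude that does
# not degrade with the coercivity constant

Helper for crux `MobilityGap` (stmt-QuantumFields-9150, route `WilsonMobilityGap`, line `Sketch`; lead
prover-line-stmt-QuantumFields-9150-c5-0, 2026-08-16).  Companion of the tree's
`Literature.Analysis.Matrix.coercive_combes_thomas` / `accretive_combes_thomas`, whose amplitude `2/g`
(resp. `2/m`) blows up as the floor `g` (resp. the accretivity constant `m`) tends to `0`.  Here the
`ℓ²`-accretivity `m Σ|v|² ≤ Re⟨v, Av⟩` is supplemented by a POINTWISE coercivity of the real part of the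
form, `|v_i|²/K ≤ Re⟨v, Av⟩` for every coordinate `i` (for lattice operators this is a Sobolev /
ultraviolet-finiteness input, available in dimension `d ≥ 3`), and the conclusion is
`|A⁻¹ᵢⱼ| ≤ K e^{−θ dist(i,j)}` with the rate `θ` limited only by `h(e^θ − 1) ≤ m`: the amplitude is the
pointwise constant `K`, uniformly in `m ↓ 0`.

Proof.  Fix the column `j`, `x := A⁻¹ e_j`, weights `d_k := e^{θ dist(k,j)}`, `v := d·x`.  As in the
coercive form, `A v = e_j − E v` with the Combes–Thomas perturbation `E`, `Σ|Ev|² ≤ η² Σ|v|²`,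
`η = h(e^θ − 1) ≤ m` (Schur).  Hence `Re⟨v, Av⟩ = Re conj(v_j) − Re⟨v, Ev⟩ ≤ |v_j| + η Σ|v|²`, and the
pointwise coercivity gives `|v_i|²/K + m Σ|v|² ≤ |v_j| + m Σ|v|²`, i.e. `|v_i|² ≤ K |v_j|` for EVERY `i`.
At `i = j` this is `|v_j| ≤ K`, whence `|v_i| ≤ K` for all `i`, i.e. `e^{θ dist(i,j)} |A⁻¹ᵢⱼ| ≤ K`.
Nothing depends on `|ι|`.

References: Combes–Thomas, Comm. Math. Phys. 34 (1973) 251 [CombesThomas1973]; Aizenman–Warzel,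
*Random Operators*, GSM 168 (2015), §10.3 [AizenmanWarzel2015].  The pointwise variant is folklore
(it is the Combes–Thomas argument run with the Green-function bound of a transient comparison walk).
Pure theorem file (no definitions).
-/

noncomputable section

open Finset
open scoped Matrix ComplexConjugate

namespace Summit.QuantumFields.QCD.Theorems.MobilityGapPositiveMass

/-- **The pointwise-coercive Combes–Thomas bound.**  Let `dist` be an `ℕ`-valued pseudo-metric on
the finite index set `ι` and `A : Matrix ι ι ℂ` a range-one matrix (`A i j ≠ 0 → dist i j ≤ 1`) whose
absolute row and column sums over `{dist ≠ 0}` are at most `h`.  Assume the POINTWISE COERCIVITY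
`|v_i|²/K + m Σ_k |v_k|² ≤ Re Σ_k conj(v_k) (Av)_k` for all `v` and all `i` (`K, m > 0`), and let
`θ ≥ 0` satisfy `h(e^θ − 1) ≤ m`.  Then `A` is invertible and `|A⁻¹ᵢⱼ| ≤ K e^{−θ dist(i,j)}` for all
`i, j` — the amplitude is `K`, independent of `m`. [folklore] -/
theorem pointwise_coercive_combes_thomas :
    ∀ {ι : Type*} [Fintype ι] [DecidableEq ι] (dist : ι → ι → ℕ), (∀ i, dist i i = 0) →
    (∀ i j, dist i j = dist j i) → (∀ i j k, dist i k ≤ dist i j + dist j k) →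
    ∀ (A : Matrix ι ι ℂ), (∀ i j, A i j ≠ 0 → dist i j ≤ 1) → ∀ (h : ℝ),
    (∀ i, ∑ j ∈ Finset.univ.filter (fun j => dist i j ≠ 0), ‖A i j‖ ≤ h) →
    (∀ j, ∑ i ∈ Finset.univ.filter (fun i => dist i j ≠ 0), ‖A i j‖ ≤ h) →
    ∀ (K m θ : ℝ), 0 < K → 0 < m → 0 ≤ θ →
    (∀ (v : ι → ℂ) (i : ι), ‖v i‖ ^ 2 / K + m * ∑ k, ‖v k‖ ^ 2 ≤ (∑ k, star (v k) * (A *ᵥ v) k).re) →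
    h * (Real.exp θ - 1) ≤ m →
    IsUnit A.det ∧ ∀ i j, ‖A⁻¹ i j‖ ≤ K * Real.exp (-(θ * dist i j)) := by
  intro ι _ _ dist hd0 hds hdt A hrange h hrow hcol K m θ hK hm hθ hpc hη
  -- (1) `A` is injective by accretivity, hence invertible
  have hdet : IsUnit A.det := by
    rw [isUnit_iff_ne_zero, Ne, ← Matrix.exists_mulVec_eq_zero_iff]
    rintro ⟨x, hx, hAx⟩
    obtain ⟨j₀, hj₀⟩ := Function.ne_iff.mp hx
    have h2 : ‖x j₀‖ ^ 2 ≤ ∑ i, ‖x i‖ ^ 2 :=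
      Finset.single_le_sum (f := fun i => ‖x i‖ ^ 2) (fun i _ => by positivity) (mem_univ j₀)
    have h3 : 0 < ‖x j₀‖ ^ 2 := by positivity
    have h4 : (∑ k, star (x k) * (A *ᵥ x) k).re = 0 := by simp [hAx]
    have h5 := hpc x j₀
    rw [h4] at h5
    have h6 : 0 < m * ∑ i, ‖x i‖ ^ 2 := mul_pos hm (h3.trans_le h2)
    have h7 : 0 ≤ ‖x j₀‖ ^ 2 / K := by positivity
    linarith
  refine ⟨hdet, fun i j => ?_⟩
  -- (2) the column `j` of `A⁻¹`
  obtain ⟨x, hx⟩ : ∃ x : ι → ℂ, x = A⁻¹ *ᵥ Pi.single j 1 := ⟨_, rfl⟩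
  have hxK : ∀ k, x k = A⁻¹ k j := fun k => by
    rw [hx, Matrix.mulVec_single_one, Matrix.col_apply]
  have hAx : A *ᵥ x = Pi.single j 1 := by
    rw [hx, Matrix.mulVec_mulVec, Matrix.mul_nonsing_inv _ hdet, Matrix.one_mulVec]
  -- (3) the weights, the weighted column and the Combes–Thomas perturbation
  set η : ℝ := h * (Real.exp θ - 1) with hηdef
  set d : ι → ℝ := fun k => Real.exp (θ * dist k j) with hd
  set v : ι → ℂ := fun k => (d k : ℂ) * x k with hv
  set Ep : Matrix ι ι ℂ := Matrix.of fun l k =>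
    A l k * ((Real.exp (θ * ((dist l j : ℝ) - dist k j)) - 1 : ℝ) : ℂ) with hEp
  set S : ℝ := ∑ k, ‖v k‖ ^ 2 with hS
  have hexp0 : 0 ≤ Real.exp θ - 1 := by linarith [Real.add_one_le_exp θ]
  have hh0 : 0 ≤ h := (Finset.sum_nonneg fun j _ => norm_nonneg _).trans (hrow j)
  have hη0 : 0 ≤ η := mul_nonneg hh0 hexp0
  have hS0 : 0 ≤ S := Finset.sum_nonneg fun k _ => by positivity
  -- the algebra: `(A v)_l + (E v)_l = d_l (A x)_l`
  have hpl : ∀ l, (A *ᵥ v) l + (Ep *ᵥ v) l = (d l : ℂ) * (A *ᵥ x) l := by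
    intro l
    simp only [hEp, hv, Matrix.mulVec, dotProduct, Matrix.of_apply]
    rw [← Finset.sum_add_distrib, Finset.mul_sum]
    refine Finset.sum_congr rfl fun k _ => ?_
    have hc : Real.exp (θ * ((dist l j : ℝ) - dist k j)) * d k = d l := by
      simp only [hd]; rw [← Real.exp_add]; ring_nf
    have hc' : ((Real.exp (θ * ((dist l j : ℝ) - dist k j)) : ℝ) : ℂ) * (d k : ℂ) =
        (d l : ℂ) := by exact_mod_cast hc
    simp only [Complex.ofReal_sub, Complex.ofReal_one]
    linear_combination (A l k * x k) * hc'
  have hdj : d j = 1 := by simp [hd, hd0]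
  -- hence `A v = e_j − E v` (`d_j = 1`)
  have hAv : ∀ l, (A *ᵥ v) l = (Pi.single j 1 : ι → ℂ) l - (Ep *ᵥ v) l := by
    intro l
    rw [eq_sub_iff_add_eq, hpl l, hAx]
    by_cases hl : l = j
    · subst hl
      rw [hdj, Complex.ofReal_one, one_mul]
    · rw [Pi.single_eq_of_ne hl, mul_zero]
  -- (4) Schur's test: `Σ|(E v)_l|² ≤ η² S`
  have hEp_le : ∀ l k, ‖Ep l k‖ ≤ (Real.exp θ - 1) * (if dist l k ≠ 0 then ‖A l k‖ else 0) := by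
    intro l k
    simp only [hEp, Matrix.of_apply]
    exact Literature.Analysis.Matrix.norm_mul_exp_sub_one_le dist A hrange hθ l k
      (Literature.Analysis.Matrix.abs_natDist_sub_natDist_le dist hds hdt l k j)
  have hsum : ∀ (f₁ f₂ : ι → ℝ) (nz : ι → Prop) [DecidablePred nz],
      (∀ k, f₁ k ≤ (Real.exp θ - 1) * (if nz k then f₂ k else 0)) →
        ∑ k ∈ univ.filter nz, f₂ k ≤ h → ∑ k, f₁ k ≤ η := by
    intro f₁ f₂ nz _ hf hb
    calc ∑ k, f₁ k ≤ ∑ k, (Real.exp θ - 1) * (if nz k then f₂ k else 0) :=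
          sum_le_sum fun k _ => hf k
      _ = (Real.exp θ - 1) * ∑ k ∈ univ.filter nz, f₂ k := by rw [← mul_sum, sum_filter]
      _ ≤ η := by rw [hηdef, mul_comm h]; exact mul_le_mul_of_nonneg_left hb hexp0
  have hSp : ∑ l, ‖(Ep *ᵥ v) l‖ ^ 2 ≤ η ^ 2 * S := by
    simpa only [← pow_two] using
      Literature.Analysis.Matrix.sum_norm_sq_mulVec_le_of_rowSum_le_of_colSum_le Ep hη0
        (fun l => hsum _ _ _ (fun k => hEp_le l k) (hrow l))
        (fun k => hsum _ _ _ (fun l => hEp_le l k) (hcol k)) v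
  -- (5) the real part of the form on the weighted column: `Re⟨v, Av⟩ ≤ |v_j| + η S`
  have hform : (∑ k, star (v k) * (A *ᵥ v) k).re ≤ ‖v j‖ + η * S := by
    have hsplit : ∑ k, star (v k) * (A *ᵥ v) k =
        star (v j) - ∑ k, star (v k) * (Ep *ᵥ v) k := by
      have h1 : ∑ k, star (v k) * (A *ᵥ v) k =
          ∑ k, (star (v k) * (Pi.single j 1 : ι → ℂ) k - star (v k) * (Ep *ᵥ v) k) :=
        Finset.sum_congr rfl fun k _ => by rw [hAv k, mul_sub]
      rw [h1, Finset.sum_sub_distrib]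
      congr 1
      rw [Finset.sum_eq_single j (fun k _ hk => by simp [Pi.single_eq_of_ne hk]) (by simp)]
      simp
    have hEv : ‖∑ k, star (v k) * (Ep *ᵥ v) k‖ ≤ η * S := by
      have h1 : ‖star v ⬝ᵥ (Ep *ᵥ v)‖ ≤
          Real.sqrt S * Real.sqrt (∑ l, ‖(Ep *ᵥ v) l‖ ^ 2) :=
        Literature.Analysis.Matrix.norm_star_dotProduct_le_sqrt_mul_sqrt v (Ep *ᵥ v)
      have h2 : Real.sqrt (∑ l, ‖(Ep *ᵥ v) l‖ ^ 2) ≤ η * Real.sqrt S := by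
        calc Real.sqrt (∑ l, ‖(Ep *ᵥ v) l‖ ^ 2) ≤ Real.sqrt (η ^ 2 * S) := Real.sqrt_le_sqrt hSp
          _ = η * Real.sqrt S := by rw [Real.sqrt_mul (sq_nonneg η), Real.sqrt_sq hη0]
      have h3 : Real.sqrt S * Real.sqrt (∑ l, ‖(Ep *ᵥ v) l‖ ^ 2) ≤ η * S := by
        calc Real.sqrt S * Real.sqrt (∑ l, ‖(Ep *ᵥ v) l‖ ^ 2)
            ≤ Real.sqrt S * (η * Real.sqrt S) :=
              mul_le_mul_of_nonneg_left h2 (Real.sqrt_nonneg _)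
          _ = η * (Real.sqrt S * Real.sqrt S) := by ring
          _ = η * S := by rw [Real.mul_self_sqrt hS0]
      have h4 : star v ⬝ᵥ (Ep *ᵥ v) = ∑ k, star (v k) * (Ep *ᵥ v) k := rfl
      rw [← h4]
      exact h1.trans h3
    rw [hsplit, Complex.sub_re]
    have h5 : (star (v j)).re ≤ ‖v j‖ := by
      calc (star (v j)).re ≤ ‖star (v j)‖ := Complex.re_le_norm _
        _ = ‖v j‖ := norm_star _
    have h6 : -(∑ k, star (v k) * (Ep *ᵥ v) k).re ≤ η * S := by
      calc -(∑ k, star (v k) * (Ep *ᵥ v) k).re ≤ |(∑ k, star (v k) * (Ep *ᵥ v) k).re| :=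
            neg_le_abs _
        _ ≤ ‖∑ k, star (v k) * (Ep *ᵥ v) k‖ := Complex.abs_re_le_norm _
        _ ≤ η * S := hEv
    linarith
  -- (6) pointwise coercivity on the weighted column: `|v_i|² ≤ K |v_j|` for every `i`
  have hpt : ∀ i', ‖v i'‖ ^ 2 ≤ K * ‖v j‖ := by
    intro i'
    have h1 := hpc v i'
    have h2 : η * S ≤ m * S := mul_le_mul_of_nonneg_right hη hS0
    have h3 : ‖v i'‖ ^ 2 / K ≤ ‖v j‖ := by linarith [h1.trans hform]
    rwa [div_le_iff₀ hK, mul_comm] at h3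
  -- (7) at `i = j`: `|v_j| ≤ K`, hence `|v_i| ≤ K` for all `i`
  have hvj : ‖v j‖ ≤ K := by
    by_cases h0 : ‖v j‖ = 0
    · rw [h0]; exact hK.le
    · have hpos : 0 < ‖v j‖ := lt_of_le_of_ne (norm_nonneg _) (Ne.symm h0)
      have h1 := hpt j
      rw [pow_two] at h1
      exact le_of_mul_le_mul_right h1 hpos
  have hvi : ‖v i‖ ≤ K := by
    have h1 : ‖v i‖ ^ 2 ≤ K ^ 2 := by
      calc ‖v i‖ ^ 2 ≤ K * ‖v j‖ := hpt i
        _ ≤ K * K := mul_le_mul_of_nonneg_left hvj hK.le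
        _ = K ^ 2 := (pow_two K).symm
    exact (pow_le_pow_iff_left₀ (norm_nonneg _) hK.le two_ne_zero).mp h1
  -- (8) unweight: `|v_i| = e^{θ dist(i,j)} |A⁻¹ i j|`
  have hvi' : ‖v i‖ = d i * ‖x i‖ := by
    simp only [hv]
    rw [norm_mul, Complex.norm_real, Real.norm_eq_abs, abs_of_pos (Real.exp_pos _)]
  rw [hvi'] at hvi
  rw [← hxK i, Real.exp_neg, ← div_eq_mul_inv, le_div_iff₀ (Real.exp_pos _), mul_comm]
  exact hvi

end Summit.QuantumFields.QCD.Theorems.MobilityGapPositiveMass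

end
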